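import Summits.QuantumFields.YangMills.Theorems.FluctuationComparisonRegPrIntLS2BetaCoarseCurlTransports
import Summits.QuantumFields.YangMills.Theorems.FluctuationComparisonRegPrIntLS2BetaChartReadDerivStructure
import HarnessLib

/-!
# S2β · (CURL-AVG, FILE B) THE COARSE COVARIANT CURL OF THE LINEARISED (0.4) AVERAGE IS THE COMB MEAN OF THE FINE LINEARISED CURLS OVER THE `L × L` SQUARES, PLUS FIRST-ORDER DEFECTS:
# `‖Y_{Ū(U₀)}(∂p′)[Q₁^{R₀}(U₀)Y]‖ ≤ |I|⁻¹Σ_i Σ_{q ⊂ R_{L×L}(x_i)} ‖Y_{U₀}(∂q)‖ + L²·2δ(3L+2)·‖Y‖ + 48·α·L·‖Y‖ + (2α_p + 24α)·ℓ·‖Y‖` (over (F1) ✓p825248, FILE A ✓p829604 and FILE B1 `…CoarseCurlTransports`)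

Cell `ym3-torus` (YM ladder rung R3 = continuum `SU(2)` Yang–Mills on the three-torus at fixed lattice data — a RUNG: NOT d = 4, NOT infinite volume, NOT a mass gap,
NOT Clay).  Width seat `ym3-torus-px13` (gen 26); crux `stmt-QuantumFields-20520`, LINE g18-1 S2β, pairing lane, AVG₂♭-ax_q ∕ `hLoc` ⟸ SUP chain ⟸ (ST) ⟸ (SCT) + lift recursion
(px17 g22 UV3-NODE §94.5); THIS FILE is the per-step brick (CURL-AVG) «the one-step (0.4) average transports linearised covariant curls by DILUTED Stokes» (px16 g22 lane GO
16:56:35Z) at FIRST ORDER, i.e. for the `R₀` form `Q₁^{R₀}(U₀)Y = covLinAvgR0 U₀ Y` of the linearised average ([Balaban1985Averaging] Prop. 3 (124)–(125); lit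
`BlockAveragingEMLLinearisedBackground`), whose structure is (F1) ✓`norm_covLinAvgR0_sub_structure_avgFun_le`: `Q₁^{R₀}Y = LM + D_{Ū}(SM) + e`, `‖e‖ ≤ 6αℓ‖Y‖` — comb-transported
LINE MEAN `LM`, covariant coarse GRADIENT of the stair mean `SM`, error `e`.  `--kind proof --supports stmt-QuantumFields-20520 --as helper`, count-neutral, DEFINITION-FREE;
generic `P : Params`, `SU(N)`, level `j → j+1`, matrix-valued bond fields `Y`; the record's average `Ū = avgFun expMeanLogSU`.

NOTATION (written out in every signature).  Coarse plaquette `p′ = (y; μ, ν)` read as the word `w = [μ⁺, ν⁺, μ̄, ν̄]` from `y`; its bonds `c₁ = ⟨y,μ⟩, c₂ = ⟨y+e_μ,ν⟩, c₃ = ⟨y+e_ν,μ⟩,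
c₄ = ⟨y,ν⟩`; the LINEARISED COVARIANT CURL of a coarse bond field `Z` at the background `V`: `Y_V(∂p′)[Z] := covWalkSum V Z (walk y w)`; comb index `i = (r, σ, σ′) ∈ Idx P`,
comb point `x_i = walkEnd (emb y) Γ^σ(n_r)`, staircase holonomy `A_i = U₀(Γ^σ_{emb y → x_i})`; `LM(c) = |I|⁻¹Σ_i A^{(c₋)}_i·Y_{U₀}([x^{(c₋)}_i, x^{(c₋)}_i + L e_{dir c}])·A^{(c₋)}_i⋆`;
loop guard `dist1 (loopHol U₀ c i) ≤ α` at EVERY coarse bond and index; `ℓ = (d+2)L`; fine plaquette guard `PlaqSmall δ U₀`; `dist1 Ū(U₀)(∂p′) ≤ α_p`.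

WHAT IS PROVED (sorry-free).
* §1 `walkEnd_plaq`; ★`norm_covWalkSum_covGrad_plaq_le` — a covariant GRADIENT `c ↦ Φ(c₋) − V_cΦ(c₊)V_c⋆` has linearised curl `= Φ(y) − V(∂p′)Φ(y)V(∂p′)⋆`, norm `≤ 2·dist1 V(∂p′)·‖Φ(y)‖`
  (over ✓`Prop7CovLinAvgPureGauge.covWalkSum_pureGauge_walk`).
* §2 ★★`norm_curl_covLinAvgR0_sub_curl_lineMean_le` — **`‖Y_{Ū}(∂p′)[Q₁^{R₀}Y] − Y_{Ū}(∂p′)[LM]‖ ≤ 2α_p·ℓ‖Y‖ + 24α·ℓ‖Y‖`** (the stair part is a gradient; the error has 4 bond terms).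
* (§3–§6 = FILE B1 ✓`…CoarseCurlTransports`: the four-term expansions `covWalkSum_walk_plaq_eq` ∕ `covWalkSum_walk_rect_eq`, the transport mismatches `dist1_mismatch₂∕₃∕₄_le`,
  and the per-index comparison ★★`norm_lineTerms_sub_conj_rect_le` `≤ 48·α·L·M`.)
* §7 ★★★`norm_curl_lineMean_sub_mean_rect_le` — **`‖Y_{Ū}(∂p′)[LM] − |I|⁻¹Σ_i A_i·Y_{U₀}(walk x_i (μ^L ν^L μ̄^L ν̄^L))·A_i⋆‖ ≤ 48·α·L·M`**.
* §8 ★★★`norm_curl_covLinAvgR0_le` — **(CURL-AVG)**: with FILE A ✓`norm_covWalkSum_rect_le` on every square,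
  **`‖Y_{Ū(U₀)}(∂p′)[Q₁^{R₀}(U₀)Y]‖ ≤ |I|⁻¹Σ_i Σ_{s,t<L}‖Y_{U₀}(walk (x_i + (s+1)e_μ + t e_ν) [ν⁺, μ̄, ν̄, μ⁺])‖ + L·L·2δ(L+2L+2)·‖Y‖ + 48α·L‖Y‖ + (2α_p + 24α)·ℓ‖Y‖`** —
  every fine plaquette's linearised curl enters with weight `|I|⁻¹·#{i : q ⊂ R(x_i)}` (the DILUTION: `L²` plaquettes per square against `L^d` comb points per block — summed over a
  coarse plaquette's worth of fine plaquettes this is the `L^{2−d}` of the sup-curvature tower (SCT)), all other terms are first order in `δ, α, α_p` times `‖Y‖`.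

WHY (UV3-NODE §93–§94; px17 g22 (SCT)→(ST); px16 g22 lane).  The sup chain's discharger needs, per RG step, «coarse linearised curvature ≤ diluted fine linearised curvature +
O(background curvature)·size»; chord-level ∕ group-level Stokes loses the dilution near the combs, only the LINEARISED stair cancellation (the stair part is a pure covariant
gradient, §1–§2) gives it.  FILE C (next) adds the true derivative `Dψ_{U₀}(0)` ((D1) ✓p824693, defect `404ℓα`) and the nonlinear `ψ` ((β-3) ✓p828183) on top of this `R₀` statement.

HONEST.  Lattice kinematics ∕ matrix algebra ∕ bookkeeping over LANDED letters ((F1) ✓p825248, FILE A ✓p829604, lit `covWalkSum`, `loopHol_eq`, `dist1_corr_le_two_mul`); nothing of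
Bałaban's analysis is asserted; the true-derivative and nonlinear editions (FILE C), (SCT), (ST), LOC ∕ `hLoc`, AVG₂♭-ax_q, GAP♯∘ (registry 3732b7df UNTOUCHED, 0∕5), the five REGISTERED
stubs, S2β, crux 20520, 19936, 19200, `YM3TorusSU2` — NOT proved; rung R3 = SU(2) YM₃ on T³ at fixed lattice data — NOT d = 4, NOT infinite volume, NOT a mass gap, NOT Clay; the
Yang–Mills mass gap is NOT proved.  Axioms standard.

References: [Balaban1985Averaging] CMP **98** (1985) (9)–(10) p.19, (19)–(20) p.21, Prop. 1 (51) p.26, (58) p.27, (62)–(63) p.28, Prop. 3 (124)–(126) p.36; [Balaban1987RG1]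
CMP **109** (1987) (0.3)–(0.4) pp.252–253.
-/

set_option autoImplicit false

noncomputable section

open scoped Matrix.Norms.L2Operator BigOperators
open Finset

namespace Summit.QuantumFields.YangMills.Theorems.FluctuationComparisonRegPrIntLS2BetaCoarseCurlOfLinAvg

open Literature.MathematicalPhysics.QuantumFieldTheory.Balaban1983to89
open Literature.MathematicalPhysics.QuantumFieldTheory.Balaban1983to89.T4Continuum
open Literature.MathematicalPhysics.QuantumFieldTheory.Balaban1983to89.BlockAveraging (Idx avgFun loopHol off corr Small)
open Literature.MathematicalPhysics.QuantumFieldTheory.Balaban1983to89.ExpMeanLog (expMeanLogSU deltaSU)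
open Literature.MathematicalPhysics.QuantumFieldTheory.Balaban1983to89.BlockAveragingEMLLinearised (stepFactor length_walk)
open Literature.MathematicalPhysics.QuantumFieldTheory.Balaban1983to89.BlockAveragingEMLLinearisedBackground
  (covStep covWalkSum covWalkSum_nil covWalkSum_cons covWalkSum_append covWalkSum_add covLinAvgR0 norm_covWalkSum_le covWalkSum_walk_wordRev)
open Literature.MathematicalPhysics.QuantumFieldTheory.Balaban1983to89.B10StarCount (shift_unshift unshift_shift)
open Literature.MathematicalPhysics.QuantumFieldTheory.Balaban1983to89.Node00
open Literature.MathematicalPhysics.QuantumFieldTheory.Balaban1983to89.BlockAveragingEMLProp2 (shift_shift_comm walkEnd_stairWord_replicate loopHol_eq dist1_corr_le_two_mul)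
open Summit.QuantumFields.YangMills.Theorems.Prop7CovLinAvgPureGauge (covWalkSum_pureGauge_walk)
open Summit.QuantumFields.YangMills.Theorems.Prop7HolRatioPerStep (norm_mean_le')
open Summit.QuantumFields.YangMills.Theorems.FluctuationComparisonRegPrIntLS2BetaChartReadDerivStructure (norm_stairMean_le norm_covLinAvgR0_sub_structure_avgFun_le)
open Summit.QuantumFields.YangMills.Theorems.FluctuationComparisonRegPrIntLS2BetaCovWalkSumStokes
open Summit.QuantumFields.YangMills.Theorems.FluctuationComparisonRegPrIntLS2BetaCoarseCurlTransports

variable {P : Params} {j : ℕ} {N : ℕ} [NeZero N]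

/-! ## §1 The plaquette walk at the coarse level: it closes, and a covariant gradient has curl = its conjugation defect -/

section Plaq

/-- The plaquette word `μ⁺ ν⁺ μ̄ ν̄` returns to its base site. [folklore] -/
theorem walkEnd_plaq {k : ℕ} (y : Site P k) (μ ν : Fin P.d) : walkEnd y [((μ, true) : Letter P.d), (ν, true), (μ, false), (ν, false)] = y := by
  funext κ
  rw [walkEnd_apply, netDisp_cons, netDisp_cons, netDisp_cons, netDisp_cons]
  simp only [netDisp, List.map_nil, List.sum_nil, Bool.false_eq_true, ↓reduceIte]
  by_cases h1 : μ = κ <;> by_cases h2 : ν = κ <;> simp [h1, h2]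

/-- **A COVARIANT GRADIENT HAS LINEARISED CURL EQUAL TO ITS CONJUGATION DEFECT**: for a coarse site function `Φ` and background `V`,
`Y_V(∂p)` of `c ↦ Φ(c₋) − V_c Φ(c₊) V_c⋆` equals `Φ(y) − V(∂p)·Φ(y)·V(∂p)⋆`, of norm `≤ 2·dist1 V(∂p)·‖Φ(y)‖`. [cite: Balaban1985Averaging, (62)-(63) p.28, (19) p.21] -/
theorem norm_covWalkSum_covGrad_plaq_le {k : ℕ} (V : GaugeField P k (SU N)) (Φ : Site P k → Matrix (Fin N) (Fin N) ℂ) (y : Site P k) (μ ν : Fin P.d) :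
    ‖covWalkSum V (fun c : PBond P k => Φ c.src - ((V c : SU N) : Matrix (Fin N) (Fin N) ℂ) * Φ c.tgt * star ((V c : SU N) : Matrix (Fin N) (Fin N) ℂ)) (walk y [((μ, true) : Letter P.d), (ν, true), (μ, false), (ν, false)])‖ ≤
      2 * dist1 (holAt V (walk y [((μ, true) : Letter P.d), (ν, true), (μ, false), (ν, false)])) * ‖Φ y‖ := by
  rw [covWalkSum_pureGauge_walk V Φ y, walkEnd_plaq]
  rw [← norm_neg, neg_sub]
  exact norm_conj_sub_self_le _ _

end Plaq

/-! ## §2 ★★ The curl of `Q₁^{R₀}(U₀)Y` is the curl of the comb-transported line mean up to `O(α)` -/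

section Curl

/-- ★★ **THE STAIR PART OF THE LINEARISED AVERAGE CARRIES NO CURL TO FIRST ORDER**: at a background `U₀` in the loop `α`-guard at EVERY coarse bond (`α < δ_N`, `α ≤ 1∕6`), with
`α_p ≥ dist1` of the averaged field's holonomy around the coarse plaquette `p = (y; μ, ν)`:
`‖Y_{Ū(U₀)}(∂p)[Q₁^{R₀}(U₀)Y] − Y_{Ū(U₀)}(∂p)[LM_{U₀}(Y)]‖ ≤ 2·α_p·ℓ·‖Y‖ + 24·α·ℓ·‖Y‖`, `ℓ = (d+2)L`, `LM_{U₀}(Y)(c) = |I|⁻¹Σ_i A_i·Y_{U₀}([x_i, x_i′])·A_i⋆` the comb-transported line mean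
((F1) ✓`norm_covLinAvgR0_sub_structure_avgFun_le`: `Q₁^{R₀}Y = LM + D_{Ū}(SM) + e`, `‖e‖ ≤ 6αℓ‖Y‖`; the covariant gradient's curl is its conjugation defect, §1; `‖SM‖ ≤ ℓ‖Y‖`).
[cite: Balaban1985Averaging, Prop. 3 (124)-(126) p.36, (62)-(63) p.28, (19) p.21] -/
theorem norm_curl_covLinAvgR0_sub_curl_lineMean_le (U₀ : GaugeField P j (SU N)) (Y : PBond P j → Matrix (Fin N) (Fin N) ℂ) {α : ℝ}
    (hα : ∀ (c : PBond P (j + 1)) (i : Idx P), dist1 (loopHol U₀ c i) ≤ α) (hαδ : α < deltaSU (Fin N)) (hα6 : α ≤ 1 / 6)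
    (y : Site P (j + 1)) (μ ν : Fin P.d) {αp : ℝ} (hαp : dist1 (holAt (avgFun (expMeanLogSU (n := Fin N)) U₀) (walk y [((μ, true) : Letter P.d), (ν, true), (μ, false), (ν, false)])) ≤ αp) :
    ‖covWalkSum (avgFun (expMeanLogSU (n := Fin N)) U₀) (covLinAvgR0 U₀ Y) (walk y [((μ, true) : Letter P.d), (ν, true), (μ, false), (ν, false)]) -
        covWalkSum (avgFun (expMeanLogSU (n := Fin N)) U₀) (fun c : PBond P (j + 1) => ((Fintype.card (Idx P) : ℂ))⁻¹ • ∑ i : Idx P,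
        ((holAt U₀ (walk (emb c.src) (stairWord i.2.1 (off i.1))) : SU N) : Matrix (Fin N) (Fin N) ℂ) *
          covWalkSum U₀ Y (walk (walkEnd (emb c.src) (stairWord i.2.1 (off i.1))) (List.replicate P.L (c.dir, true))) *
        star ((holAt U₀ (walk (emb c.src) (stairWord i.2.1 (off i.1))) : SU N) : Matrix (Fin N) (Fin N) ℂ)) (walk y [((μ, true) : Letter P.d), (ν, true), (μ, false), (ν, false)])‖ ≤
      2 * αp * ((((P.d + 2) * P.L : ℕ) : ℝ) * ‖Y‖) + 24 * α * ((((P.d + 2) * P.L : ℕ) : ℝ) * ‖Y‖) := by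
  classical
  set V := (avgFun (expMeanLogSU (n := Fin N)) U₀) with hV
  set LM : PBond P (j + 1) → Matrix (Fin N) (Fin N) ℂ := (fun c : PBond P (j + 1) => ((Fintype.card (Idx P) : ℂ))⁻¹ • ∑ i : Idx P,
        ((holAt U₀ (walk (emb c.src) (stairWord i.2.1 (off i.1))) : SU N) : Matrix (Fin N) (Fin N) ℂ) *
          covWalkSum U₀ Y (walk (walkEnd (emb c.src) (stairWord i.2.1 (off i.1))) (List.replicate P.L (c.dir, true))) *
        star ((holAt U₀ (walk (emb c.src) (stairWord i.2.1 (off i.1))) : SU N) : Matrix (Fin N) (Fin N) ℂ)) with hLM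
  set Φ : Site P (j + 1) → Matrix (Fin N) (Fin N) ℂ := (fun z : Site P (j + 1) => ((Fintype.card (Idx P) : ℂ))⁻¹ • ∑ i : Idx P, covWalkSum U₀ Y (walk (emb z) (stairWord i.2.1 (off i.1)))) with hΦ
  set DΦ : PBond P (j + 1) → Matrix (Fin N) (Fin N) ℂ := fun c => Φ c.src - ((V c : SU N) : Matrix (Fin N) (Fin N) ℂ) * Φ c.tgt * star ((V c : SU N) : Matrix (Fin N) (Fin N) ℂ) with hDΦ
  set e : PBond P (j + 1) → Matrix (Fin N) (Fin N) ℂ := fun c => covLinAvgR0 U₀ Y c - LM c - DΦ c with he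
  have hα0 : 0 ≤ α := (GaugeGroup.dist1_nonneg _).trans (hα ⟨y, μ⟩ (Classical.arbitrary _))
  -- pointwise decomposition and its linear image
  have hdec : covLinAvgR0 U₀ Y = LM + (DΦ + e) := by
    funext c; simp only [Pi.add_apply, he]; abel
  have hsum : covWalkSum V (covLinAvgR0 U₀ Y) (walk y [((μ, true) : Letter P.d), (ν, true), (μ, false), (ν, false)]) =
      covWalkSum V LM (walk y [((μ, true) : Letter P.d), (ν, true), (μ, false), (ν, false)]) + (covWalkSum V DΦ (walk y [((μ, true) : Letter P.d), (ν, true), (μ, false), (ν, false)]) + covWalkSum V e (walk y [((μ, true) : Letter P.d), (ν, true), (μ, false), (ν, false)])) := by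
    rw [hdec, covWalkSum_add, covWalkSum_add]
  -- the error field is small at every coarse bond ((F1))
  have he_le : ∀ c : PBond P (j + 1), ‖e c‖ ≤ 6 * α * ((((P.d + 2) * P.L : ℕ) : ℝ) * ‖Y‖) := by
    intro c
    have h := norm_covLinAvgR0_sub_structure_avgFun_le (n := Fin N) U₀ Y c (hα c) hαδ hα6
    have ee : e c = covLinAvgR0 U₀ Y c - (LM c + Φ c.src - ((V c : SU N) : Matrix (Fin N) (Fin N) ℂ) * Φ c.tgt * star ((V c : SU N) : Matrix (Fin N) (Fin N) ℂ)) := by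
      simp only [he, hDΦ]; abel
    rw [ee]
    exact h
  -- the curl of the error field
  have hcurl_e : ‖covWalkSum V e (walk y [((μ, true) : Letter P.d), (ν, true), (μ, false), (ν, false)])‖ ≤ 4 * (6 * α * ((((P.d + 2) * P.L : ℕ) : ℝ) * ‖Y‖)) := by
    have h := norm_covWalkSum_le V he_le (walk y [((μ, true) : Letter P.d), (ν, true), (μ, false), (ν, false)])
    rw [length_walk] at h
    simpa using h
  -- the curl of the covariant gradient
  have hcurl_D : ‖covWalkSum V DΦ (walk y [((μ, true) : Letter P.d), (ν, true), (μ, false), (ν, false)])‖ ≤ 2 * αp * ((((P.d + 2) * P.L : ℕ) : ℝ) * ‖Y‖) := by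
    have h := norm_covWalkSum_covGrad_plaq_le V Φ y μ ν
    have hΦy : ‖Φ y‖ ≤ (((P.d + 2) * P.L : ℕ) : ℝ) * ‖Y‖ := norm_stairMean_le (n := Fin N) U₀ Y y
    have hd0 : 0 ≤ dist1 (holAt V (walk y [((μ, true) : Letter P.d), (ν, true), (μ, false), (ν, false)])) := GaugeGroup.dist1_nonneg _
    calc ‖covWalkSum V DΦ (walk y [((μ, true) : Letter P.d), (ν, true), (μ, false), (ν, false)])‖ ≤ 2 * dist1 (holAt V (walk y [((μ, true) : Letter P.d), (ν, true), (μ, false), (ν, false)])) * ‖Φ y‖ := h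
      _ ≤ 2 * αp * ((((P.d + 2) * P.L : ℕ) : ℝ) * ‖Y‖) := by
          have := mul_le_mul hαp hΦy (norm_nonneg _) (hd0.trans hαp)
          nlinarith
  rw [hsum]
  have e2 : covWalkSum V LM (walk y [((μ, true) : Letter P.d), (ν, true), (μ, false), (ν, false)]) + (covWalkSum V DΦ (walk y [((μ, true) : Letter P.d), (ν, true), (μ, false), (ν, false)]) + covWalkSum V e (walk y [((μ, true) : Letter P.d), (ν, true), (μ, false), (ν, false)])) - covWalkSum V LM (walk y [((μ, true) : Letter P.d), (ν, true), (μ, false), (ν, false)]) =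
      covWalkSum V DΦ (walk y [((μ, true) : Letter P.d), (ν, true), (μ, false), (ν, false)]) + covWalkSum V e (walk y [((μ, true) : Letter P.d), (ν, true), (μ, false), (ν, false)]) := by abel
  rw [e2]
  calc _ ≤ ‖covWalkSum V DΦ (walk y [((μ, true) : Letter P.d), (ν, true), (μ, false), (ν, false)])‖ + ‖covWalkSum V e (walk y [((μ, true) : Letter P.d), (ν, true), (μ, false), (ν, false)])‖ := norm_add_le _ _
    _ ≤ 2 * αp * ((((P.d + 2) * P.L : ℕ) : ℝ) * ‖Y‖) + 4 * (6 * α * ((((P.d + 2) * P.L : ℕ) : ℝ) * ‖Y‖)) := add_le_add hcurl_D hcurl_e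
    _ = _ := by ring

end Curl

/-! ## §7 ★★★ The knit: the coarse curl of the line mean is the comb mean of the transported linearised `L × L` squares, up to `48·α·L·M` -/

section Knit

omit [NeZero N] in
/-- Conjugation passes through a scalar multiple of a finite sum. [folklore] -/
theorem conj_smul_sum {ι : Type*} (T T' : Matrix (Fin N) (Fin N) ℂ) (a : ℂ) (S : Finset ι) (f : ι → Matrix (Fin N) (Fin N) ℂ) :
    T * (a • ∑ i ∈ S, f i) * T' = a • ∑ i ∈ S, T * f i * T' := by
  rw [Matrix.mul_smul, Matrix.smul_mul, Finset.mul_sum, Finset.sum_mul]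

omit [NeZero N] in
/-- The norm of a mean is at most the mean of termwise bounds. [folklore] -/
private theorem norm_mean_le_mean_of_le {ι : Type*} [Fintype ι] {m : ι → Matrix (Fin N) (Fin N) ℂ} {B : ι → ℝ} (h : ∀ i, ‖m i‖ ≤ B i) :
    ‖((Fintype.card ι : ℂ))⁻¹ • ∑ i, m i‖ ≤ (Fintype.card ι : ℝ)⁻¹ * ∑ i, B i := by
  rw [norm_smul, norm_inv, Complex.norm_natCast]
  exact mul_le_mul_of_nonneg_left ((norm_sum_le _ _).trans (Finset.sum_le_sum fun i _ => h i)) (by positivity)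

/-- ★★★ **THE COARSE CURL OF THE COMB-TRANSPORTED LINE MEAN IS THE COMB MEAN OF THE TRANSPORTED LINEARISED `L × L` SQUARES, UP TO `48·α·L·M`**: at a background `U₀` in the loop
`α`-guard at every coarse bond (`α < δ_N`, `α ≤ 1∕6`) and a bond field with `‖Y b‖ ≤ M`, for the coarse plaquette `p′ = (y; μ, ν)`:
`‖Y_{Ū(U₀)}(∂p′)[LM_{U₀}(Y)] − |I|⁻¹Σ_i A_i·Y_{U₀}(walk x_i (μ^L ν^L μ̄^L ν̄^L))·A_i⋆‖ ≤ 48·α·(L·M)`, `x_i = walkEnd (emb y) Γ^σ(n_r)`, `A_i = U₀(Γ^σ_{emb y → x_i})` (§3 at the coarse level, §6 per index).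
[cite: Balaban1987RG1, (0.4) p.253; Balaban1985Averaging, (58) p.27, Prop. 3 (124)-(125) p.36] -/
theorem norm_curl_lineMean_sub_mean_rect_le (U₀ : GaugeField P j (SU N)) (Y : PBond P j → Matrix (Fin N) (Fin N) ℂ) {α : ℝ}
    (hα : ∀ (c : PBond P (j + 1)) (i : Idx P), dist1 (loopHol U₀ c i) ≤ α) (hαδ : α < deltaSU (Fin N)) (hα6 : α ≤ 1 / 6) {M : ℝ} (hY : ∀ b, ‖Y b‖ ≤ M)
    (y : Site P (j + 1)) (μ ν : Fin P.d) :
    ‖covWalkSum (avgFun (expMeanLogSU (n := Fin N)) U₀) (fun c : PBond P (j + 1) => ((Fintype.card (Idx P) : ℂ))⁻¹ • ∑ i : Idx P,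
        ((holAt U₀ (walk (emb c.src) (stairWord i.2.1 (off i.1))) : SU N) : Matrix (Fin N) (Fin N) ℂ) *
          covWalkSum U₀ Y (walk (walkEnd (emb c.src) (stairWord i.2.1 (off i.1))) (List.replicate P.L (c.dir, true))) *
        star ((holAt U₀ (walk (emb c.src) (stairWord i.2.1 (off i.1))) : SU N) : Matrix (Fin N) (Fin N) ℂ)) (walk y [((μ, true) : Letter P.d), (ν, true), (μ, false), (ν, false)]) -
      ((Fintype.card (Idx P) : ℂ))⁻¹ • ∑ i : Idx P, ((holAt U₀ (walk (emb y) (stairWord i.2.1 (off i.1))) : SU N) : Matrix (Fin N) (Fin N) ℂ) *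
          covWalkSum U₀ Y (walk (walkEnd (emb y) (stairWord i.2.1 (off i.1)))
            (List.replicate P.L (μ, true) ++ List.replicate P.L (ν, true) ++ List.replicate P.L (μ, false) ++ List.replicate P.L (ν, false))) *
        star ((holAt U₀ (walk (emb y) (stairWord i.2.1 (off i.1))) : SU N) : Matrix (Fin N) (Fin N) ℂ)‖ ≤ 48 * α * ((P.L : ℝ) * M) := by
  classical
  rw [covWalkSum_walk_plaq_eq]
  dsimp only
  rw [conj_smul_sum, conj_smul_sum, conj_smul_sum, ← smul_add, ← smul_sub, ← smul_sub, ← smul_sub, ← Finset.sum_add_distrib, ← Finset.sum_sub_distrib,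
    ← Finset.sum_sub_distrib, ← Finset.sum_sub_distrib]
  exact norm_mean_le' fun i => norm_lineTerms_sub_conj_rect_le U₀ Y hα hαδ hα6 hY y μ ν i

end Knit

/-! ## §8 ★★★ (CURL-AVG) The coarse covariant curl of the linearised (0.4) average is the comb mean of the fine linearised curls over the `L × L` squares, plus defects -/

section Final

/-- ★★★ **(CURL-AVG) — THE ONE-STEP (0.4) AVERAGE TRANSPORTS LINEARISED COVARIANT CURLS BY DILUTED STOKES**: at a background `U₀` in the loop `α`-guard at every coarse bond (`α < δ_N`, `α ≤ 1∕6`)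
with fine plaquette variables within `δ` of `1`, for the coarse plaquette `p′ = (y; μ, ν)` with `dist1 Ū(U₀)(∂p′) ≤ α_p`:
`‖Y_{Ū(U₀)}(∂p′)[Q₁^{R₀}(U₀)Y]‖ ≤ |I|⁻¹Σ_i Σ_{s,t<L} ‖Y_{U₀}(∂q_{i,s,t})‖ + L²·2δ(3L+2)·‖Y‖ + 48·α·L·‖Y‖ + (2α_p + 24α)·ℓ·‖Y‖`, where `q_{i,s,t}` is the fine plaquette of the `L × L` square at the comb
point `x_i` with lower-right corner `x_i + (s+1)e_μ + t e_ν` (read as the word `[ν⁺, μ̄, ν̄, μ⁺]`), `ℓ = (d+2)L`: EVERY fine plaquette curl enters with weight `|I|⁻¹ × #{i : q ⊂ R(x_i)}` — the dilution —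
and the rest is first order in the background's curvature (`δ`), loop flux (`α`) and coarse flux (`α_p`) times `‖Y‖` (§2 + §7 + FILE A ✓`norm_covWalkSum_rect_le`).
[cite: Balaban1985Averaging, Prop. 1 (51) p.26, Prop. 3 (124)-(126) p.36, (58) p.27, (19)-(20) p.21; Balaban1987RG1, (0.4) p.253] -/
theorem norm_curl_covLinAvgR0_le (U₀ : GaugeField P j (SU N)) (Y : PBond P j → Matrix (Fin N) (Fin N) ℂ) {α : ℝ}
    (hα : ∀ (c : PBond P (j + 1)) (i : Idx P), dist1 (loopHol U₀ c i) ≤ α) (hαδ : α < deltaSU (Fin N)) (hα6 : α ≤ 1 / 6) {δ : ℝ} (hδ : 0 ≤ δ) (hU : PlaqSmall δ U₀)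
    (y : Site P (j + 1)) (μ ν : Fin P.d) {αp : ℝ} (hαp : dist1 (holAt (avgFun (expMeanLogSU (n := Fin N)) U₀) (walk y [((μ, true) : Letter P.d), (ν, true), (μ, false), (ν, false)])) ≤ αp) :
    ‖covWalkSum (avgFun (expMeanLogSU (n := Fin N)) U₀) (covLinAvgR0 U₀ Y) (walk y [((μ, true) : Letter P.d), (ν, true), (μ, false), (ν, false)])‖ ≤
      (Fintype.card (Idx P) : ℝ)⁻¹ * ∑ i : Idx P, ∑ s ∈ Finset.range P.L, ∑ t ∈ Finset.range P.L,
          ‖covWalkSum U₀ Y (walk (walkEnd (walkEnd (emb y) (stairWord i.2.1 (off i.1))) (List.replicate (s + 1) (μ, true) ++ List.replicate t (ν, true)))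
            [((ν, true) : Letter P.d), (μ, false), (ν, false), (μ, true)])‖ +
        (P.L : ℝ) * ((P.L : ℝ) * (2 * δ * ((P.L : ℝ) + 2 * P.L + 2) * ‖Y‖)) + 48 * α * ((P.L : ℝ) * ‖Y‖) +
        (2 * αp * ((((P.d + 2) * P.L : ℕ) : ℝ) * ‖Y‖) + 24 * α * ((((P.d + 2) * P.L : ℕ) : ℝ) * ‖Y‖)) := by
  classical
  have hY : ∀ b, ‖Y b‖ ≤ ‖Y‖ := fun b => norm_le_pi_norm Y b
  set V := avgFun (expMeanLogSU (n := Fin N)) U₀ with hV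
  set w : List (Letter P.d) := [((μ, true) : Letter P.d), (ν, true), (μ, false), (ν, false)] with hw
  set LM : PBond P (j + 1) → Matrix (Fin N) (Fin N) ℂ := (fun c : PBond P (j + 1) => ((Fintype.card (Idx P) : ℂ))⁻¹ • ∑ i : Idx P,
        ((holAt U₀ (walk (emb c.src) (stairWord i.2.1 (off i.1))) : SU N) : Matrix (Fin N) (Fin N) ℂ) *
          covWalkSum U₀ Y (walk (walkEnd (emb c.src) (stairWord i.2.1 (off i.1))) (List.replicate P.L (c.dir, true))) *
        star ((holAt U₀ (walk (emb c.src) (stairWord i.2.1 (off i.1))) : SU N) : Matrix (Fin N) (Fin N) ℂ)) with hLM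
  set Sq : Matrix (Fin N) (Fin N) ℂ := ((Fintype.card (Idx P) : ℂ))⁻¹ • ∑ i : Idx P, ((holAt U₀ (walk (emb y) (stairWord i.2.1 (off i.1))) : SU N) : Matrix (Fin N) (Fin N) ℂ) *
          covWalkSum U₀ Y (walk (walkEnd (emb y) (stairWord i.2.1 (off i.1)))
            (List.replicate P.L (μ, true) ++ List.replicate P.L (ν, true) ++ List.replicate P.L (μ, false) ++ List.replicate P.L (ν, false))) *
        star ((holAt U₀ (walk (emb y) (stairWord i.2.1 (off i.1))) : SU N) : Matrix (Fin N) (Fin N) ℂ) with hSq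
  have h1 : ‖covWalkSum V (covLinAvgR0 U₀ Y) (walk y w) - covWalkSum V LM (walk y w)‖ ≤
      2 * αp * ((((P.d + 2) * P.L : ℕ) : ℝ) * ‖Y‖) + 24 * α * ((((P.d + 2) * P.L : ℕ) : ℝ) * ‖Y‖) :=
    norm_curl_covLinAvgR0_sub_curl_lineMean_le U₀ Y hα hαδ hα6 y μ ν hαp
  have h2 : ‖covWalkSum V LM (walk y w) - Sq‖ ≤ 48 * α * ((P.L : ℝ) * ‖Y‖) := norm_curl_lineMean_sub_mean_rect_le U₀ Y hα hαδ hα6 hY y μ ν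
  have h3 : ‖Sq‖ ≤ (Fintype.card (Idx P) : ℝ)⁻¹ * ∑ i : Idx P, ((∑ s ∈ Finset.range P.L, ∑ t ∈ Finset.range P.L,
          ‖covWalkSum U₀ Y (walk (walkEnd (walkEnd (emb y) (stairWord i.2.1 (off i.1))) (List.replicate (s + 1) (μ, true) ++ List.replicate t (ν, true)))
            [((ν, true) : Letter P.d), (μ, false), (ν, false), (μ, true)])‖) + (P.L : ℝ) * ((P.L : ℝ) * (2 * δ * ((P.L : ℝ) + 2 * P.L + 2) * ‖Y‖))) := by
    refine norm_mean_le_mean_of_le fun i => ?_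
    exact (norm_coe_conj_le _ _).trans (norm_covWalkSum_rect_le U₀ Y hδ hU hY (walkEnd (emb y) (stairWord i.2.1 (off i.1))) μ ν P.L P.L)
  have hsplit : (Fintype.card (Idx P) : ℝ)⁻¹ * ∑ i : Idx P, ((∑ s ∈ Finset.range P.L, ∑ t ∈ Finset.range P.L,
          ‖covWalkSum U₀ Y (walk (walkEnd (walkEnd (emb y) (stairWord i.2.1 (off i.1))) (List.replicate (s + 1) (μ, true) ++ List.replicate t (ν, true)))
            [((ν, true) : Letter P.d), (μ, false), (ν, false), (μ, true)])‖) + (P.L : ℝ) * ((P.L : ℝ) * (2 * δ * ((P.L : ℝ) + 2 * P.L + 2) * ‖Y‖))) =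
      (Fintype.card (Idx P) : ℝ)⁻¹ * ∑ i : Idx P, ∑ s ∈ Finset.range P.L, ∑ t ∈ Finset.range P.L,
          ‖covWalkSum U₀ Y (walk (walkEnd (walkEnd (emb y) (stairWord i.2.1 (off i.1))) (List.replicate (s + 1) (μ, true) ++ List.replicate t (ν, true)))
            [((ν, true) : Letter P.d), (μ, false), (ν, false), (μ, true)])‖ +
        (P.L : ℝ) * ((P.L : ℝ) * (2 * δ * ((P.L : ℝ) + 2 * P.L + 2) * ‖Y‖)) := by
    have hc : (Fintype.card (Idx P) : ℝ) ≠ 0 := Nat.cast_ne_zero.mpr Fintype.card_ne_zero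
    rw [Finset.sum_add_distrib, Finset.sum_const, Finset.card_univ, nsmul_eq_mul, mul_add, ← mul_assoc, inv_mul_cancel₀ hc, one_mul]
  have e : covWalkSum V (covLinAvgR0 U₀ Y) (walk y w) = (covWalkSum V (covLinAvgR0 U₀ Y) (walk y w) - covWalkSum V LM (walk y w)) + (covWalkSum V LM (walk y w) - Sq) + Sq := by abel
  rw [e]
  calc _ ≤ ‖covWalkSum V (covLinAvgR0 U₀ Y) (walk y w) - covWalkSum V LM (walk y w)‖ + ‖covWalkSum V LM (walk y w) - Sq‖ + ‖Sq‖ :=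
        (norm_add_le _ _).trans (add_le_add (norm_add_le _ _) le_rfl)
    _ ≤ (2 * αp * ((((P.d + 2) * P.L : ℕ) : ℝ) * ‖Y‖) + 24 * α * ((((P.d + 2) * P.L : ℕ) : ℝ) * ‖Y‖)) + 48 * α * ((P.L : ℝ) * ‖Y‖) +
          ((Fintype.card (Idx P) : ℝ)⁻¹ * ∑ i : Idx P, ∑ s ∈ Finset.range P.L, ∑ t ∈ Finset.range P.L,
              ‖covWalkSum U₀ Y (walk (walkEnd (walkEnd (emb y) (stairWord i.2.1 (off i.1))) (List.replicate (s + 1) (μ, true) ++ List.replicate t (ν, true)))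
                [((ν, true) : Letter P.d), (μ, false), (ν, false), (μ, true)])‖ +
            (P.L : ℝ) * ((P.L : ℝ) * (2 * δ * ((P.L : ℝ) + 2 * P.L + 2) * ‖Y‖))) := by
        rw [← hsplit]; exact add_le_add (add_le_add h1 h2) h3
    _ = _ := by ring

end Final

end Summit.QuantumFields.YangMills.Theorems.FluctuationComparisonRegPrIntLS2BetaCoarseCurlOfLinAvg

end
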